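import Literature.NumberTheory.LFunctions.Zhang2022.EllRegimeStatements
import HarnessLib

/-!
# Zhang (2022), B-ell first-order reading: the SET tests `ModelConsistentOn` / `ClosesFirstOrderOn` on a BOX of
# adversarial data reduce to their four corner values (cell `landau-siegel`, family B-ell; PROVED bookkeeping)

Topic `Literature/NumberTheory/LFunctions/Zhang2022` (Landau–Siegel audit tree; verdict-neutral).
Y. Zhang, arXiv:2211.02515v1 (2022) [Zhang2022LandauSiegel] is an unrefereed manuscript under
adjudication; NOTHING here asserts or denies its Theorems 1–2 and nothing here is a claim about
Landau–Siegel zeros.  Theorems only (no `def`, no new statement): elementary facts about the AFFINE first-order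
value `EllRegime.firstOrderValue gain G₀ G₁ G₂ (λ, c′) = gain + G₀ + λ·G₁ + c′·G₂` of ls-Bell-typer-1's Part 6
(`EllRegimeStatements.lean`, the SET form of the B-ell KILL-draft v0.2 F5/F6: model-admissible set `𝓜`,
admissible box `M`, two adversarial parameters — the dipole `λ` and the arithmetic detuning `c′`, ls-theory
2026-08-26T17:10:30Z (2)(b)(e)).

WHY.  The B-ell reading at T_B0+16h instantiates `ModelConsistentOn 𝓜 (data u)` for the three `K₀` vectors
(D-ELL-1-K0 table 1) and `FirstOrderEmptyOn` over the admissible box; ls-theory's ruling (δ) names `𝓜` as a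
point, a segment or a box in the `(λ, c′)`-plane.  Since the value is affine in `(λ, c′)`, on a product of closed
intervals BOTH tests are decided by the four corner values — so each kernel instantiation is four closed-form
inequalities, whatever box is ruled:

* `firstOrderValue_eq` (unfolding), `firstOrderValue_convex_fst/snd` (affine interpolation in each variable);
* `ModelConsistentOn.mono`, `ClosesFirstOrderOn.mono` (set monotonicity: consistency on a larger `𝓜`,
  closing on a larger `M`, restrict);
* `modelConsistentOn_box_iff` — on `𝓜 = Icc l₁ l₂ ×ˢ Icc c₁ c₂` (non-empty): `ModelConsistentOn ↔` the value is
  `≥ 0` at the four corners; `closesFirstOrderOn_box_iff` — `ClosesFirstOrderOn ↔` the value is `< 0` at the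
  four corners; the segment (`c₁ = c₂`) and point cases `modelConsistentOn_segment_iff`, `modelConsistentOn_point_iff`,
  `closesFirstOrderOn_segment_iff`;
* `modelConsistentOn_box_of_corners` / `closesFirstOrderOn_box_of_corners` (the directions used by certificates).

## References
* Y. Zhang, arXiv:2211.02515v1 (2022), §2 (2.13), (2.32) (the shifted detector and the criterion whose
  first-order reading these tests formalise). [Zhang2022LandauSiegel]

«The programme SEARCHES and TYPES; no claim about Landau–Siegel zeros, Theorems 1–2 of arXiv:2211.02515 or
a repaired Margin232 until a kernel theorem says so.»
-/

noncomputable section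

open Set

namespace Literature.NumberTheory.LFunctions.Zhang2022.EllRegime

variable {gain G₀ G₁ G₂ : ℝ}

/-- Unfolding: `firstOrderValue gain G₀ G₁ G₂ (λ, c′) = gain + G₀ + λ·G₁ + c′·G₂`.
[cite: Zhang2022LandauSiegel, §2 (2.13), (2.32)] -/
theorem firstOrderValue_eq (gain G₀ G₁ G₂ lam c : ℝ) :
    firstOrderValue gain G₀ G₁ G₂ (lam, c) = gain + G₀ + lam * G₁ + c * G₂ := rfl

/-- **Set monotonicity of model-consistency**: consistent on `𝓜` ⇒ consistent on every `𝓜' ⊆ 𝓜`.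
[cite: Zhang2022LandauSiegel, §2 (2.32)] -/
theorem ModelConsistentOn.mono {𝓜 𝓜' : Set (ℝ × ℝ)} (h : ModelConsistentOn 𝓜 gain G₀ G₁ G₂) (hsub : 𝓜' ⊆ 𝓜) :
    ModelConsistentOn 𝓜' gain G₀ G₁ G₂ := fun p hp => h p (hsub hp)

/-- **Set monotonicity of robust closing**: closes over `M` ⇒ closes over every `M' ⊆ M`.
[cite: Zhang2022LandauSiegel, §2 (2.32)] -/
theorem ClosesFirstOrderOn.mono {M M' : Set (ℝ × ℝ)} (h : ClosesFirstOrderOn M gain G₀ G₁ G₂) (hsub : M' ⊆ M) :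
    ClosesFirstOrderOn M' gain G₀ G₁ G₂ := fun p hp => h p (hsub hp)

/-- **Affine in `λ`**: on `l₁ ≤ lam ≤ l₂` the value at `(lam, c)` is the convex combination of the values at
`(l₁, c)` and `(l₂, c)` — precisely, with `l₂ − l₁ > 0`,
`(l₂ − l₁)·v(lam,c) = (l₂ − lam)·v(l₁,c) + (lam − l₁)·v(l₂,c)`. [cite: Zhang2022LandauSiegel, §2 (2.32)] -/
theorem firstOrderValue_convex_fst (gain G₀ G₁ G₂ l₁ l₂ lam c : ℝ) :
    (l₂ - l₁) * firstOrderValue gain G₀ G₁ G₂ (lam, c) =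
      (l₂ - lam) * firstOrderValue gain G₀ G₁ G₂ (l₁, c) + (lam - l₁) * firstOrderValue gain G₀ G₁ G₂ (l₂, c) := by
  simp only [firstOrderValue]
  ring

/-- **Affine in `c′`**: `(c₂ − c₁)·v(lam,c) = (c₂ − c)·v(lam,c₁) + (c − c₁)·v(lam,c₂)`.
[cite: Zhang2022LandauSiegel, §2 (2.13), (2.32)] -/
theorem firstOrderValue_convex_snd (gain G₀ G₁ G₂ lam c₁ c₂ c : ℝ) :
    (c₂ - c₁) * firstOrderValue gain G₀ G₁ G₂ (lam, c) =
      (c₂ - c) * firstOrderValue gain G₀ G₁ G₂ (lam, c₁) + (c - c₁) * firstOrderValue gain G₀ G₁ G₂ (lam, c₂) := by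
  simp only [firstOrderValue]
  ring

/-- An affine function of one variable that is `≥ 0` at both ends of `[a, b]` is `≥ 0` on `[a, b]`
(here: the value in `λ` at fixed `c′`). [cite: Zhang2022LandauSiegel, §2 (2.32)] -/
theorem firstOrderValue_nonneg_of_ends_fst {l₁ l₂ lam c : ℝ} (h₁ : l₁ ≤ lam) (h₂ : lam ≤ l₂)
    (v₁ : 0 ≤ firstOrderValue gain G₀ G₁ G₂ (l₁, c)) (v₂ : 0 ≤ firstOrderValue gain G₀ G₁ G₂ (l₂, c)) :
    0 ≤ firstOrderValue gain G₀ G₁ G₂ (lam, c) := by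
  rcases eq_or_lt_of_le (h₁.trans h₂) with heq | hlt
  · have : lam = l₁ := le_antisymm (heq ▸ h₂) h₁
    subst this
    exact v₁
  · have key := firstOrderValue_convex_fst gain G₀ G₁ G₂ l₁ l₂ lam c
    have hprod : 0 ≤ (l₂ - l₁) * firstOrderValue gain G₀ G₁ G₂ (lam, c) := by
      rw [key]
      exact add_nonneg (mul_nonneg (by linarith) v₁) (mul_nonneg (by linarith) v₂)
    exact nonneg_of_mul_nonneg_right (by rwa [mul_comm] at hprod) (by linarith)

/-- The same in `c′` at fixed `λ`. [cite: Zhang2022LandauSiegel, §2 (2.13), (2.32)] -/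
theorem firstOrderValue_nonneg_of_ends_snd {lam c₁ c₂ c : ℝ} (h₁ : c₁ ≤ c) (h₂ : c ≤ c₂)
    (v₁ : 0 ≤ firstOrderValue gain G₀ G₁ G₂ (lam, c₁)) (v₂ : 0 ≤ firstOrderValue gain G₀ G₁ G₂ (lam, c₂)) :
    0 ≤ firstOrderValue gain G₀ G₁ G₂ (lam, c) := by
  rcases eq_or_lt_of_le (h₁.trans h₂) with heq | hlt
  · have : c = c₁ := le_antisymm (heq ▸ h₂) h₁
    subst this
    exact v₁
  · have key := firstOrderValue_convex_snd gain G₀ G₁ G₂ lam c₁ c₂ c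
    have hprod : 0 ≤ (c₂ - c₁) * firstOrderValue gain G₀ G₁ G₂ (lam, c) := by
      rw [key]
      exact add_nonneg (mul_nonneg (by linarith) v₁) (mul_nonneg (by linarith) v₂)
    exact nonneg_of_mul_nonneg_right (by rwa [mul_comm] at hprod) (by linarith)

/-- An affine function `< 0` at both ends of `[a, b]` is `< 0` on `[a, b]` (in `λ` at fixed `c′`).
[cite: Zhang2022LandauSiegel, §2 (2.32)] -/
theorem firstOrderValue_neg_of_ends_fst {l₁ l₂ lam c : ℝ} (h₁ : l₁ ≤ lam) (h₂ : lam ≤ l₂)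
    (v₁ : firstOrderValue gain G₀ G₁ G₂ (l₁, c) < 0) (v₂ : firstOrderValue gain G₀ G₁ G₂ (l₂, c) < 0) :
    firstOrderValue gain G₀ G₁ G₂ (lam, c) < 0 := by
  rcases eq_or_lt_of_le (h₁.trans h₂) with heq | hlt
  · have : lam = l₁ := le_antisymm (heq ▸ h₂) h₁
    subst this
    exact v₁
  · have key := firstOrderValue_convex_fst gain G₀ G₁ G₂ l₁ l₂ lam c
    -- one of the two weights is positive
    have hprod : (l₂ - l₁) * firstOrderValue gain G₀ G₁ G₂ (lam, c) < 0 := by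
      rw [key]
      rcases lt_or_ge lam l₂ with hl | hl
      · exact add_neg_of_neg_of_nonpos (mul_neg_of_pos_of_neg (by linarith) v₁)
          (mul_nonpos_of_nonneg_of_nonpos (by linarith) v₂.le)
      · exact add_neg_of_nonpos_of_neg (mul_nonpos_of_nonneg_of_nonpos (by linarith) v₁.le)
          (mul_neg_of_pos_of_neg (by linarith) v₂)
    by_contra hge
    push Not at hge
    have : 0 ≤ (l₂ - l₁) * firstOrderValue gain G₀ G₁ G₂ (lam, c) := mul_nonneg (by linarith) hge
    linarith

/-- The same in `c′` at fixed `λ`. [cite: Zhang2022LandauSiegel, §2 (2.13), (2.32)] -/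
theorem firstOrderValue_neg_of_ends_snd {lam c₁ c₂ c : ℝ} (h₁ : c₁ ≤ c) (h₂ : c ≤ c₂)
    (v₁ : firstOrderValue gain G₀ G₁ G₂ (lam, c₁) < 0) (v₂ : firstOrderValue gain G₀ G₁ G₂ (lam, c₂) < 0) :
    firstOrderValue gain G₀ G₁ G₂ (lam, c) < 0 := by
  rcases eq_or_lt_of_le (h₁.trans h₂) with heq | hlt
  · have : c = c₁ := le_antisymm (heq ▸ h₂) h₁
    subst this
    exact v₁
  · have key := firstOrderValue_convex_snd gain G₀ G₁ G₂ lam c₁ c₂ c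
    have hprod : (c₂ - c₁) * firstOrderValue gain G₀ G₁ G₂ (lam, c) < 0 := by
      rw [key]
      rcases lt_or_ge c c₂ with hl | hl
      · exact add_neg_of_neg_of_nonpos (mul_neg_of_pos_of_neg (by linarith) v₁)
          (mul_nonpos_of_nonneg_of_nonpos (by linarith) v₂.le)
      · exact add_neg_of_nonpos_of_neg (mul_nonpos_of_nonneg_of_nonpos (by linarith) v₁.le)
          (mul_neg_of_pos_of_neg (by linarith) v₂)
    by_contra hge
    push Not at hge
    have : 0 ≤ (c₂ - c₁) * firstOrderValue gain G₀ G₁ G₂ (lam, c) := mul_nonneg (by linarith) hge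
    linarith

/-! ## The box, segment and point forms of the two tests -/

/-- **Model-consistency on a box from its four corners.**  If the first-order value is `≥ 0` at
`(l₁,c₁), (l₁,c₂), (l₂,c₁), (l₂,c₂)` then `ModelConsistentOn (Icc l₁ l₂ ×ˢ Icc c₁ c₂)`.
[cite: Zhang2022LandauSiegel, §2 (2.13), (2.32)] -/
theorem modelConsistentOn_box_of_corners {l₁ l₂ c₁ c₂ : ℝ}
    (v₁₁ : 0 ≤ firstOrderValue gain G₀ G₁ G₂ (l₁, c₁)) (v₁₂ : 0 ≤ firstOrderValue gain G₀ G₁ G₂ (l₁, c₂))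
    (v₂₁ : 0 ≤ firstOrderValue gain G₀ G₁ G₂ (l₂, c₁)) (v₂₂ : 0 ≤ firstOrderValue gain G₀ G₁ G₂ (l₂, c₂)) :
    ModelConsistentOn (Icc l₁ l₂ ×ˢ Icc c₁ c₂) gain G₀ G₁ G₂ := by
  rintro ⟨lam, c⟩ ⟨⟨hl₁, hl₂⟩, ⟨hc₁, hc₂⟩⟩
  exact firstOrderValue_nonneg_of_ends_snd hc₁ hc₂
    (firstOrderValue_nonneg_of_ends_fst hl₁ hl₂ v₁₁ v₂₁)
    (firstOrderValue_nonneg_of_ends_fst hl₁ hl₂ v₁₂ v₂₂)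

/-- **Model-consistency on a (non-empty) box ⇔ its four corner values are `≥ 0`.**
[cite: Zhang2022LandauSiegel, §2 (2.13), (2.32)] -/
theorem modelConsistentOn_box_iff {l₁ l₂ c₁ c₂ : ℝ} (hl : l₁ ≤ l₂) (hc : c₁ ≤ c₂) :
    ModelConsistentOn (Icc l₁ l₂ ×ˢ Icc c₁ c₂) gain G₀ G₁ G₂ ↔
      0 ≤ firstOrderValue gain G₀ G₁ G₂ (l₁, c₁) ∧ 0 ≤ firstOrderValue gain G₀ G₁ G₂ (l₁, c₂) ∧
      0 ≤ firstOrderValue gain G₀ G₁ G₂ (l₂, c₁) ∧ 0 ≤ firstOrderValue gain G₀ G₁ G₂ (l₂, c₂) := by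
  refine ⟨fun h => ⟨h _ ⟨⟨le_rfl, hl⟩, ⟨le_rfl, hc⟩⟩, h _ ⟨⟨le_rfl, hl⟩, ⟨hc, le_rfl⟩⟩,
    h _ ⟨⟨hl, le_rfl⟩, ⟨le_rfl, hc⟩⟩, h _ ⟨⟨hl, le_rfl⟩, ⟨hc, le_rfl⟩⟩⟩, fun h => ?_⟩
  exact modelConsistentOn_box_of_corners h.1 h.2.1 h.2.2.1 h.2.2.2

/-- **Robust closing on a box from its four corners** (all four `< 0`).
[cite: Zhang2022LandauSiegel, §2 (2.13), (2.32)] -/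
theorem closesFirstOrderOn_box_of_corners {l₁ l₂ c₁ c₂ : ℝ}
    (v₁₁ : firstOrderValue gain G₀ G₁ G₂ (l₁, c₁) < 0) (v₁₂ : firstOrderValue gain G₀ G₁ G₂ (l₁, c₂) < 0)
    (v₂₁ : firstOrderValue gain G₀ G₁ G₂ (l₂, c₁) < 0) (v₂₂ : firstOrderValue gain G₀ G₁ G₂ (l₂, c₂) < 0) :
    ClosesFirstOrderOn (Icc l₁ l₂ ×ˢ Icc c₁ c₂) gain G₀ G₁ G₂ := by
  rintro ⟨lam, c⟩ ⟨⟨hl₁, hl₂⟩, ⟨hc₁, hc₂⟩⟩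
  exact firstOrderValue_neg_of_ends_snd hc₁ hc₂
    (firstOrderValue_neg_of_ends_fst hl₁ hl₂ v₁₁ v₂₁)
    (firstOrderValue_neg_of_ends_fst hl₁ hl₂ v₁₂ v₂₂)

/-- **Robust closing on a (non-empty) box ⇔ its four corner values are `< 0`.**
[cite: Zhang2022LandauSiegel, §2 (2.13), (2.32)] -/
theorem closesFirstOrderOn_box_iff {l₁ l₂ c₁ c₂ : ℝ} (hl : l₁ ≤ l₂) (hc : c₁ ≤ c₂) :
    ClosesFirstOrderOn (Icc l₁ l₂ ×ˢ Icc c₁ c₂) gain G₀ G₁ G₂ ↔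
      firstOrderValue gain G₀ G₁ G₂ (l₁, c₁) < 0 ∧ firstOrderValue gain G₀ G₁ G₂ (l₁, c₂) < 0 ∧
      firstOrderValue gain G₀ G₁ G₂ (l₂, c₁) < 0 ∧ firstOrderValue gain G₀ G₁ G₂ (l₂, c₂) < 0 := by
  refine ⟨fun h => ⟨h _ ⟨⟨le_rfl, hl⟩, ⟨le_rfl, hc⟩⟩, h _ ⟨⟨le_rfl, hl⟩, ⟨hc, le_rfl⟩⟩,
    h _ ⟨⟨hl, le_rfl⟩, ⟨le_rfl, hc⟩⟩, h _ ⟨⟨hl, le_rfl⟩, ⟨hc, le_rfl⟩⟩⟩, fun h => ?_⟩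
  exact closesFirstOrderOn_box_of_corners h.1 h.2.1 h.2.2.1 h.2.2.2

/-- **Segment case** (`c′` pinned at `c₀`, `λ ∈ [l₁, l₂]`): model-consistency ⇔ the two end values are `≥ 0`.
[cite: Zhang2022LandauSiegel, §2 (2.32)] -/
theorem modelConsistentOn_segment_iff {l₁ l₂ c₀ : ℝ} (hl : l₁ ≤ l₂) :
    ModelConsistentOn (Icc l₁ l₂ ×ˢ {c₀}) gain G₀ G₁ G₂ ↔
      0 ≤ firstOrderValue gain G₀ G₁ G₂ (l₁, c₀) ∧ 0 ≤ firstOrderValue gain G₀ G₁ G₂ (l₂, c₀) := by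
  rw [show ({c₀} : Set ℝ) = Icc c₀ c₀ from (Icc_self c₀).symm, modelConsistentOn_box_iff hl le_rfl]
  tauto

/-- **Segment case for closing**: ⇔ the two end values are `< 0`. [cite: Zhang2022LandauSiegel, §2 (2.32)] -/
theorem closesFirstOrderOn_segment_iff {l₁ l₂ c₀ : ℝ} (hl : l₁ ≤ l₂) :
    ClosesFirstOrderOn (Icc l₁ l₂ ×ˢ {c₀}) gain G₀ G₁ G₂ ↔
      firstOrderValue gain G₀ G₁ G₂ (l₁, c₀) < 0 ∧ firstOrderValue gain G₀ G₁ G₂ (l₂, c₀) < 0 := by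
  rw [show ({c₀} : Set ℝ) = Icc c₀ c₀ from (Icc_self c₀).symm, closesFirstOrderOn_box_iff hl le_rfl]
  tauto

/-- **Point case** (the MODEL POINT `(λ_model, c′_model)` of KILL-draft v0.1): model-consistency on a singleton
is the one inequality `0 ≤ gain + G₀ + λ_model·G₁ + c′_model·G₂`. [cite: Zhang2022LandauSiegel, §2 (2.32)] -/
theorem modelConsistentOn_point_iff {lam₀ c₀ : ℝ} :
    ModelConsistentOn {(lam₀, c₀)} gain G₀ G₁ G₂ ↔ 0 ≤ gain + G₀ + lam₀ * G₁ + c₀ * G₂ := by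
  simp [ModelConsistentOn, firstOrderValue]

/-- A model-consistent datum inside the admissible box kills robust closing over the box (Part 6's
`not_closesFirstOrderOn_of_modelConsistentOn` with the membership spelled out). [cite: Zhang2022LandauSiegel, §2 Lemma 2.3, (2.32)] -/
theorem not_closesFirstOrderOn_of_mem {𝓜 M : Set (ℝ × ℝ)} {p : ℝ × ℝ} (h : ModelConsistentOn 𝓜 gain G₀ G₁ G₂)
    (hp𝓜 : p ∈ 𝓜) (hpM : p ∈ M) : ¬ ClosesFirstOrderOn M gain G₀ G₁ G₂ :=
  not_closesFirstOrderOn_of_modelConsistentOn h ⟨p, hp𝓜, hpM⟩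

end Literature.NumberTheory.LFunctions.Zhang2022.EllRegime

end
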